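import Literature.AlgebraicGeometry.GroupSchemes.UnitComponentOfFiniteGroupScheme
import Literature.RingTheory.Henselian.FiniteFlatHopfAlgebraRankCount
import Mathlib.AlgebraicGeometry.Morphisms.Flat
import HarnessLib

/-!
# `rank G = #G(k) · rank G⁰`: the order of a finite flat group scheme over a henselian local ring is the number of its geometric points
# times the order of its unit component ([Tate1997FiniteFlatGroupSchemes] (3.7)) — scheme dress

Topic `Literature/AlgebraicGeometry/GroupSchemes`; namespace `Literature.AlgebraicGeometry.GroupSchemes`.  THEOREMS ONLY (no definition ∕ instance ∕
notation ∕ named fact ∕ `sorry`).  Cell `pub/hodgecm-mathlib` (D-0151), FLOOR 0, P6 «MOD programme», sub-line P6b `Cruxes/HLiu418/Lines/F0_P6b_ConnectedEtale.lean`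
ED. 2, stub `stub_b1cg_rankEqCardMulRank_geom` (σ1 «HOPF-corner over `k`»); `--supports stmt-HodgeConjecture-24832`.  HC_CM is proved only modulo the
printed citations until rung 0 closes; count-neutral generic algebraic geometry.

THE PRINT.  [Tate1997FiniteFlatGroupSchemes] (3.7) (pp. 140–142): `G` finite flat over a henselian local `R`, `G⁰` the connected component of the
unit; over the algebraic closure of the residue field the local factors of `Γ(G)` are permuted transitively by the points, so
`[G : R] = #G(k̄) · [G⁰ : R]`.  The ALGEBRA is ★ `Henselian.finrank_eq_card_algHom_mul_finrank_unitCorner_of_isLocalRing` (`rank_R B = #(B →ₐ[R] k) ·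
rank_R (B ⧸ (1 − e))` for the unit separating idempotent `e`); THIS FILE is the scheme dress in the currency of the cell's line (group objects of
`Over (Spec R)`, a unit component `j : G₀ ⟶ G` = homomorphism + open and closed immersion + connected source, coordinate rings PRESENTED by
isomorphisms `G.left ≅ Spec B` over `R`, points `Spec k → G.left` over `Spec R`):

* §1 **presentations**: an `R`-isomorphism `eB : G.left ≅ Spec B` (`eB ≫ Spec (R → B) = G → Spec R`) gives `Γ(G, 𝒪_G) ≃ₐ[R] B` — the `B`-valued
  point `eB⁻¹` of `G` has a bijective algebra map (★ `AffineGroupScheme.ptEquiv`, `ofHom_ptEquiv`; `Spec` reflects isomorphisms)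
  (`bijective_ptEquiv_of_isIso_left`, `finrank_eq_finrank_alg_of_iso`);
* §2 **uniqueness of the unit component**: the range of a unit component is THE connected component of the unit point
  (`range_eq_connectedComponent_of_unitComponent`), so any unit component is isomorphic over `G` to `Spec (Γ(G) ⧸ (1 − e))` (★
  `exists_grpObj_isMonHom_quotIncl_unitIdempotent`) and `rank_R Γ(G₀) = rank_R (Γ(G) ⧸ (1 − e))` (`finrank_alg_unitComponent_eq_finrank_unitCorner`);
* §3 `Γ(G)` is FREE over the local `R` when `G → Spec R` is finite flat (`free_alg_of_flat`);
* §4 HEAD **`finrank_eq_card_points_mul_finrank_of_unitComponent`** — the text of the cell's `stub_b1cg_rankEqCardMulRank_geom` with its predicate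
  `IsUnitComponent` unfolded: `rank_R B = #{t : Spec k → G over φ ∘ residue} · rank_R B₀` for every algebraically closed `k` over `κ(R)` and all
  presentations `B`, `B₀` of `G`, `G₀`.

## References
* [Tate1997FiniteFlatGroupSchemes] J. Tate, *Finite flat group schemes*, in: Modular Forms and Fermat's Last Theorem (1997), (3.7) (pp. 140–142).
* [StacksProject] The Stacks Project, Tag 04GG; Tags 00EC ∕ 00EE (idempotents and open-and-closed subsets of `Spec`).
-/

set_option autoImplicit false

noncomputable section

universe u

open CategoryTheory CategoryTheory.Limits AlgebraicGeometry IsLocalRing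
open scoped MonObj

namespace Literature.AlgebraicGeometry.GroupSchemes

open Literature.AlgebraicGeometry.Motives

/-! ## §1 Presentations `G.left ≅ Spec B` over `R` give `Γ(G, 𝒪_G) ≃ₐ[R] B` -/

section Presentation

variable {R : Type u} [CommRing R] (G : Over (Spec (.of R))) [IsAffine G.left] {B : Type u} [CommRing B] [Algebra R B]

/-- **A point of `G` whose underlying morphism is an isomorphism has a BIJECTIVE algebra map `Γ(G, 𝒪_G) → B`** (★ `AffineGroupScheme.ptEquiv`;
its ring map is `Spec⁻¹` of `Spec B ≅ G ≅ Spec Γ(G)`, ★ `ofHom_ptEquiv`, and `Spec` reflects isomorphisms). [cite: StacksProject, Tag 04GG] -/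
theorem bijective_ptEquiv_of_isIso_left (u : specOver R B ⟶ G) (hu : IsIso u.left) :
    Function.Bijective (AffineGroupScheme.ptEquiv G B u) := by
  have h := AffineGroupScheme.ofHom_ptEquiv G u
  -- `Spec⁻¹` of an isomorphism is an isomorphism (`Spec` is fully faithful)
  let i : Spec (CommRingCat.of B) ≅ Spec (CommRingCat.of (AffineGroupScheme.Alg G)) := @asIso _ _ _ _ u.left hu ≪≫ G.left.isoSpec
  have h' : CommRingCat.ofHom (AffineGroupScheme.ptEquiv G B u).toRingHom = Spec.preimage i.hom := h
  have h1 : Spec.preimage i.hom ≫ Spec.preimage i.inv = 𝟙 _ := Spec.map_injective (by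
    rw [Spec.map_comp, Spec.map_preimage, Spec.map_preimage, Iso.inv_hom_id, Spec.map_id])
  have h2 : Spec.preimage i.inv ≫ Spec.preimage i.hom = 𝟙 _ := Spec.map_injective (by
    rw [Spec.map_comp, Spec.map_preimage, Spec.map_preimage, Iso.hom_inv_id, Spec.map_id])
  haveI : IsIso (Spec.preimage i.hom) := ⟨⟨Spec.preimage i.inv, h1, h2⟩⟩
  haveI : IsIso (CommRingCat.ofHom (AffineGroupScheme.ptEquiv G B u).toRingHom) := by rw [h']; infer_instance
  exact (asIso (CommRingCat.ofHom (AffineGroupScheme.ptEquiv G B u).toRingHom)).commRingCatIsoToRingEquiv.bijective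

/-- **`Γ(G, 𝒪_G) ≃ₐ[R] B` from a presentation** `eB : G.left ≅ Spec B` over `R` (`eB ≫ Spec (R → B) = G.hom`): the `B`-valued point `eB⁻¹` of
`G` over `R`. [cite: StacksProject, Tag 04GG] -/
theorem nonempty_algEquiv_alg_of_iso (eB : G.left ≅ Spec (.of B))
    (heB : eB.hom ≫ Spec.map (CommRingCat.ofHom (algebraMap R B)) = G.hom) : Nonempty (AffineGroupScheme.Alg G ≃ₐ[R] B) := by
  have hw : eB.inv ≫ G.hom = (specOver R B).hom := by rw [← heB, Iso.inv_hom_id_assoc]; rfl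
  let u : specOver R B ⟶ G := Over.homMk eB.inv hw
  have hu : IsIso u.left := by change IsIso eB.inv; infer_instance
  exact ⟨AlgEquiv.ofBijective _ (bijective_ptEquiv_of_isIso_left G u hu)⟩

/-- … hence equal `R`-ranks: `rank_R B = rank_R Γ(G, 𝒪_G)`. [cite: StacksProject, Tag 04GG] -/
theorem finrank_eq_finrank_alg_of_iso (eB : G.left ≅ Spec (.of B))
    (heB : eB.hom ≫ Spec.map (CommRingCat.ofHom (algebraMap R B)) = G.hom) :
    Module.finrank R B = Module.finrank R (AffineGroupScheme.Alg G) := by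
  obtain ⟨ψ⟩ := nonempty_algEquiv_alg_of_iso G eB heB
  exact ψ.toLinearEquiv.finrank_eq.symm

end Presentation

/-! ## §2 Uniqueness of the unit component: its range is the connected component of the unit point -/

section Unique

variable {R : Type u} [CommRing R] {G : Over (Spec (.of R))} [GrpObj G]

/-- **The range of a unit component is the connected component of the unit point.**  If `j : G₀ ⟶ G` is a homomorphism of group objects of
`Over (Spec R)` whose underlying morphism is an open and closed immersion with connected source, then `range j = ` the connected component of
`η(x)` for any point `x` of the base (a clopen connected subset containing that point). [cite: StacksProject, Tag 00EE] [cite: Tate1997FiniteFlatGroupSchemes, (3.7) (I) (p. 141)] -/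
theorem range_eq_connectedComponent_of_unitComponent {G₀ : Over (Spec (.of R))} [GrpObj G₀] (j : G₀ ⟶ G) (hj : IsMonHom j)
    (ho : IsOpenImmersion j.left) (hc : IsClosedImmersion j.left) (hconn : ConnectedSpace ↥G₀.left) (x : ↥(Spec (.of R))) :
    Set.range j.left.base = connectedComponent (η[G].left.base x) := by
  have hmem : η[G].left.base x ∈ Set.range j.left.base := by
    haveI := hj
    have h1 : η[G₀] ≫ j = η[G] := IsMonHom.one_hom (f := j)
    refine ⟨η[G₀].left.base x, ?_⟩
    rw [← Scheme.Hom.comp_apply, ← Over.comp_left, h1]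
  have hclopen : IsClopen (Set.range j.left.base) :=
    ⟨j.left.isClosedEmbedding.isClosed_range, j.left.isOpenEmbedding.isOpen_range⟩
  have hconn' : _root_.IsPreconnected (Set.range j.left.base) := (isConnected_range j.left.base.hom.continuous).isPreconnected
  exact Set.Subset.antisymm (hconn'.subset_connectedComponent hmem) (hclopen.connectedComponent_subset hmem)

/-- **Uniqueness of the unit component up to isomorphism over `G`**: two unit components `j : G₀ ⟶ G`, `j' : G₀' ⟶ G` have the same range, hence
`G₀.left ≅ G₀'.left` compatibly with `j`, `j'` (Mathlib `IsOpenImmersion.isoOfRangeEq`).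
[cite: Tate1997FiniteFlatGroupSchemes, (3.7) (I) (p. 141)] [cite: StacksProject, Tag 00EE] -/
theorem exists_iso_left_of_unitComponents [IsLocalRing R] {G₀ G₀' : Over (Spec (.of R))} [GrpObj G₀] [GrpObj G₀'] (j : G₀ ⟶ G)
    (hj : IsMonHom j)
    (ho : IsOpenImmersion j.left) (hc : IsClosedImmersion j.left) (hconn : ConnectedSpace ↥G₀.left) (j' : G₀' ⟶ G) (hj' : IsMonHom j')
    (ho' : IsOpenImmersion j'.left) (hc' : IsClosedImmersion j'.left) (hconn' : ConnectedSpace ↥G₀'.left) :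
    ∃ i : G₀.left ≅ G₀'.left, i.hom ≫ j'.left = j.left := by
  have hr : Set.range j.left.base = Set.range j'.left.base := by
    rw [range_eq_connectedComponent_of_unitComponent j hj ho hc hconn (IsLocalRing.closedPoint R),
      range_eq_connectedComponent_of_unitComponent j' hj' ho' hc' hconn']
  exact ⟨IsOpenImmersion.isoOfRangeEq j.left j'.left (by simpa using hr), IsOpenImmersion.isoOfRangeEq_hom_fac _ _ _⟩

end Unique

/-! ## §3 `Γ(G, 𝒪_G)` is free for `G → Spec R` finite flat over a local ring -/

section Free

variable {R : Type u} [CommRing R] (G : Over (Spec (.of R))) [IsAffine G.left]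

/-- `G → Spec R` flat ⇒ `Γ(G, 𝒪_G)` is a flat `R`-module (★ `AffineGroupScheme.isoSpecOver`: `G ≅ Spec Γ(G)` over `R`; Mathlib
`HasRingHomProperty @Flat RingHom.Flat`). [cite: StacksProject, Tag 04GG] -/
theorem flat_alg_of_flat [Flat G.hom] : Module.Flat R (AffineGroupScheme.Alg G) := by
  have hw : (AffineGroupScheme.isoSpecOver G).inv.left ≫ G.hom = (specOver R (AffineGroupScheme.Alg G)).hom :=
    Over.w (AffineGroupScheme.isoSpecOver G).inv
  have hflat : Flat (Spec.map (CommRingCat.ofHom (algebraMap R (AffineGroupScheme.Alg G)))) := by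
    change Flat (specOver R (AffineGroupScheme.Alg G)).hom
    rw [← hw]; infer_instance
  have h := (HasRingHomProperty.Spec_iff (P := @Flat) (Q := RingHom.Flat)).mp hflat
  exact RingHom.flat_algebraMap_iff.mp h

/-- `G → Spec R` finite flat over a LOCAL ring ⇒ `Γ(G, 𝒪_G)` is a (finite) FREE `R`-module. [cite: StacksProject, Tag 04GG] -/
theorem free_alg_of_flat [IsLocalRing R] [IsFinite G.hom] [Flat G.hom] : Module.Free R (AffineGroupScheme.Alg G) := by
  haveI := AffineGroupScheme.Alg.moduleFinite G
  haveI := flat_alg_of_flat G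
  exact Module.free_of_flat_of_isLocalRing

end Free

/-! ## §4 HEAD: `rank_R B = #G(k) · rank_R B₀` -/

section Head

variable {R : Type u} [CommRing R] [HenselianLocalRing R]

/-- **The unit component has the rank of the unit corner**: for a finite group object `G` of `Over (Spec R)` over a henselian local `R` and ANY
unit component `j : G₀ ⟶ G` (homomorphism, open and closed immersion, connected source), `rank_R Γ(G₀, 𝒪) = rank_R (Γ(G, 𝒪) ⧸ (1 − e))` for the
unit separating idempotent `e` of ★ `exists_grpObj_isMonHom_quotIncl_unitIdempotent` (uniqueness §2 + presentations §1).
[cite: Tate1997FiniteFlatGroupSchemes, (3.7) (I) (p. 141)] -/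
theorem finrank_alg_unitComponent_eq_finrank_unitCorner (G : Over (Spec (.of R))) [GrpObj G] [IsAffine G.left] [IsFinite G.hom]
    {G₀ : Over (Spec (.of R))} [GrpObj G₀] [IsAffine G₀.left] (j : G₀ ⟶ G) (hj : IsMonHom j) (ho : IsOpenImmersion j.left)
    (hc : IsClosedImmersion j.left) (hconn : ConnectedSpace ↥G₀.left) :
    ∃ e : AffineGroupScheme.Alg G, IsIdempotentElem e ∧
      e - 1 ∈ RingHom.ker ((residue R).comp (Bialgebra.counitAlgHom R (AffineGroupScheme.Alg G) : _ →+* R)) ∧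
      (∀ 𝔫 : Ideal (AffineGroupScheme.Alg G), 𝔫.IsMaximal →
        𝔫 ≠ RingHom.ker ((residue R).comp (Bialgebra.counitAlgHom R (AffineGroupScheme.Alg G) : _ →+* R)) → e ∈ 𝔫) ∧
      Module.finrank R (AffineGroupScheme.Alg G₀) = Module.finrank R (AffineGroupScheme.Alg G ⧸ Ideal.span {1 - e}) := by
  obtain ⟨e, he, he1, he0, -, -, GZ, hjq, hoq, hcq, hconnq⟩ := exists_grpObj_isMonHom_quotIncl_unitIdempotent R G
  refine ⟨e, he, he1, he0, ?_⟩
  letI := GZ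
  obtain ⟨i, hi⟩ := exists_iso_left_of_unitComponents j hj ho hc hconn
    (AffineGroupScheme.quotIncl G (Ideal.span {1 - e})) hjq hoq hcq hconnq
  -- `i : G₀.left ≅ Spec (Γ(G) ⧸ (1 - e))` is a presentation of `G₀` over `R`
  have hw : i.hom ≫ Spec.map (CommRingCat.ofHom (algebraMap R (AffineGroupScheme.Alg G ⧸ Ideal.span {1 - e}))) = G₀.hom := by
    have h1 : (AffineGroupScheme.quotIncl G (Ideal.span {1 - e})).left ≫ G.hom =
        (specOver R (AffineGroupScheme.Alg G ⧸ Ideal.span {1 - e})).hom := Over.w _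
    have h2 : j.left ≫ G.hom = G₀.hom := Over.w j
    rw [← h2, ← hi, Category.assoc, h1]
    rfl
  exact (finrank_eq_finrank_alg_of_iso G₀ i hw).symm

/-- **TATE (3.7): `rank G = #G(k) · rank G⁰`** — the text of the cell's `stub_b1cg_rankEqCardMulRank_geom` (`Lines/F0_P6b_ConnectedEtale.lean` ED. 2)
with its predicate `IsUnitComponent` unfolded.  Let `R` be a henselian local ring, `k` an ALGEBRAICALLY CLOSED field with `φ : κ(R) → k`, `G` a
FINITE FLAT group object of `Over (Spec R)` with a unit component `j : G₀ ⟶ G` (homomorphism, open and closed immersion, connected source), and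
`eB : G.left ≅ Spec B`, `eB₀ : G₀.left ≅ Spec B₀` presentations over `R`.  Then `rank_R B = #{t : Spec k → G over φ ∘ residue} · rank_R B₀`.
Proof: `B ≃ₐ[R] Γ(G)` and `B₀ ≃ₐ[R] Γ(G₀)` (§1), `rank_R Γ(G₀) = rank_R (Γ(G) ⧸ (1 − e))` (§2), the points are `Γ(G) →ₐ[R] k` (★ `AffineGroupScheme.ptEquiv`),
and the algebra count ★ `Henselian.finrank_eq_card_algHom_mul_finrank_unitCorner_of_isLocalRing` for the free (§3) finite Hopf algebra `Γ(G)`.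
[cite: Tate1997FiniteFlatGroupSchemes, (3.7) (pp. 140–142)] [cite: StacksProject, Tag 04GG] -/
theorem finrank_eq_card_points_mul_finrank_of_unitComponent (k : Type u) [Field k] [IsAlgClosed k] (φ : ResidueField R →+* k)
    (G G₀ : Over (Spec (.of R))) [GrpObj G] [GrpObj G₀] (j : G₀ ⟶ G) (hGf : IsFinite G.hom) (hGfl : Flat G.hom)
    (hj : IsMonHom j ∧ IsOpenImmersion j.left ∧ IsClosedImmersion j.left ∧ ConnectedSpace ↥G₀.left)
    (B : Type u) [CommRing B] [Algebra R B] (eB : G.left ≅ Spec (.of B))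
    (heB : eB.hom ≫ Spec.map (CommRingCat.ofHom (algebraMap R B)) = G.hom)
    (B₀ : Type u) [CommRing B₀] [Algebra R B₀] (eB₀ : G₀.left ≅ Spec (.of B₀))
    (heB₀ : eB₀.hom ≫ Spec.map (CommRingCat.ofHom (algebraMap R B₀)) = G₀.hom) :
    Module.finrank R B =
      Nat.card {t : Spec (.of k) ⟶ G.left // t ≫ G.hom = Spec.map (CommRingCat.ofHom (φ.comp (residue R)))} * Module.finrank R B₀ := by
  obtain ⟨hjm, ho, hc, hconn⟩ := hj
  haveI := hGf
  haveI := hGfl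
  haveI : IsAffine G.left := AffineGroupScheme.isAffine_left_of_isAffineHom G
  haveI : IsClosedImmersion j.left := hc
  haveI : IsOpenImmersion j.left := ho
  haveI : IsFinite G₀.hom := (isFinite_and_flat_of_immersions j).1
  haveI : IsAffine G₀.left := AffineGroupScheme.isAffine_left_of_isAffineHom G₀
  haveI := AffineGroupScheme.Alg.moduleFinite G
  haveI := free_alg_of_flat G
  -- the structure map `R → k` through the residue field
  letI : Algebra R k := (φ.comp (residue R)).toAlgebra
  have hk : maximalIdeal R ≤ RingHom.ker (algebraMap R k) := fun r hr => by
    rw [RingHom.mem_ker, RingHom.algebraMap_toAlgebra, RingHom.comp_apply, (IsLocalRing.residue_eq_zero_iff r).mpr hr, map_zero]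
  -- unit idempotent and the rank of the unit component
  obtain ⟨e, he, he1, he0, hB₀⟩ := finrank_alg_unitComponent_eq_finrank_unitCorner G j hjm ho hc hconn
  -- the algebra count for `Γ(G)`
  have hcount := Literature.RingTheory.Henselian.finrank_eq_card_algHom_mul_finrank_unitCorner_of_isLocalRing (k := k)
    (B := AffineGroupScheme.Alg G) hk he he1 he0
  -- points `Spec k → G` over `φ ∘ residue` are the `k`-points `Γ(G) →ₐ[R] k`
  have hpts : Nat.card {t : Spec (.of k) ⟶ G.left // t ≫ G.hom = Spec.map (CommRingCat.ofHom (φ.comp (residue R)))} =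
      Nat.card (AffineGroupScheme.Alg G →ₐ[R] k) := by
    refine Nat.card_congr (Equiv.trans ?_ (AffineGroupScheme.ptEquiv G k))
    exact
      { toFun := fun x => Over.homMk x.1 x.2
        invFun := fun u => ⟨u.left, Over.w u⟩
        left_inv := fun _ => rfl
        right_inv := fun _ => rfl }
  rw [finrank_eq_finrank_alg_of_iso G eB heB, finrank_eq_finrank_alg_of_iso G₀ eB₀ heB₀, hB₀, hpts]
  exact hcount

end Head

end Literature.AlgebraicGeometry.GroupSchemes

end
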